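import Summits.NavierStokesRegularity.NavierStokesRegularity.Theorems.TypeILiouvilleTypeIliouvilleNoTypeIITotalSpeedRung
import Literature.Analysis.FluidPDE.NSFiniteEnergySmoothProofs
import Literature.Analysis.FluidPDE.TaoLocalisationHolds
import HarnessLib

/-!
# §B CANDIDATE 2 `SupSpeedBudget(q)` (lens `transfer`, STATUS 2026-08-26T17:38:44Z): its two
# support stubs PROVED — `FrameIsStrong` and `BudgetKillsHyperfast`

The candidate (HOME/ns-plan-lens-transfer-typeII/SupSpeedBudget.lean, sha16 773c08c2…) is the
a-priori sup-speed time budget `∫₀ᵀ ‖u(t)‖_∞^q dt ≤ K_q(ν^{-3q/4}E^{q/2}T^{1-3q/4} + E^{2-q}ν^{3q-5})` on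
the Foias–Guillopé–Temam/Tao frame (classical on the closed slab, strong class, dissipation `≤ E`),
`q = 1` being the tree theorem.  Its typed consequence on the Type-II axis runs through two support
statements declared «to be proved» in the package; both are settled here, DEF-FREE and with the
package's definitions unfolded verbatim, so that the route's stubs close by `exact` at birth:

* `frameIsStrong` — `FrameIsStrong`: a maximal smooth Leray–Hopf solution from a rapidly decaying
  datum is in the strong class `HasBoundedSobolevNormsOn (Icc 0 T') u` on every closed sub-slab
  `T' < T` (the tree's `tao2011_hasBoundedSobolevNormsOn_holds`, Tao 2013 Cor. 11.1, with the slice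
  energies bounded by the datum's);
* `budgetKillsHyperfast` — `BudgetKillsHyperfast q β`: if `1 ≤ q`, `1 ≤ β q` and the budget holds
  with exponent `q` for all strong closed-slab solutions, then NO first blow-up of the frame has a
  PERSISTENT sup rate `‖u(t)‖_∞ ≥ c (T - t)^{-β}` (`c > 0`): on the sub-slabs `[0, T']` the budget is
  uniform in `T' ↑ T` (dissipation `≤ C∫|u₀|²` by the tree's `tao_finite_energy_smooth_energy_bound_holds`,
  Tao 2013 Lemma 8.1; the bound's `T'`-dependence `T'^{1-3q/4}` is monotone of one sign), so
  `∫₀ᵀ ‖u‖_∞^q < ∞` by exhaustion, while a persistent rate with `βq ≥ 1` forces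
  `‖u(t)‖_∞^q ≥ c^q/(T - t)` on a final interval, whose integral diverges
  (`RateChain.lintegral_inv_sub_Ioo_eq_top`).

WHAT THIS IS NOT: not NS; the budget itself (`q > 1`) stays OPEN — these are its kit-side rungs.
[folklore]
-/

noncomputable section

-- the summit and its single problem share the name (D-0017 nested layout)
set_option linter.dupNamespace false

open MeasureTheory Set Function Filter TopologicalSpace Metric
open scoped Topology NNReal ENNReal

namespace Summit.NavierStokesRegularity.NavierStokesRegularity.Theorems.TypeIliouvilleNoTypeII.RateChain

open Literature.Analysis Literature.Analysis.FluidPDE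

variable {ν T : ℝ} {u : ℝ → EuclideanSpace ℝ (Fin 3) → EuclideanSpace ℝ (Fin 3)}
  {p : ℝ → EuclideanSpace ℝ (Fin 3) → ℝ}

/-! ### `FrameIsStrong` -/

/-- **The frame is strong on closed sub-slabs** (the package's `FrameIsStrong`, unfolded): a maximal
smooth solution on `[0, T)`, Leray–Hopf from a rapidly decaying datum, has all Sobolev norms bounded
on `[0, T']` for every `T' < T` (Tao 2013, Cor. 11.1: `tao2011_hasBoundedSobolevNormsOn_holds` on
`[0, max T' (T/2)]`). [cite: Tao2011, Cor. 11.1] -/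
theorem frameIsStrong :
    ∀ (ν T : ℝ), 0 < ν → 0 < T →
      ∀ (u : ℝ → EuclideanSpace ℝ (Fin 3) → EuclideanSpace ℝ (Fin 3))
        (p : ℝ → EuclideanSpace ℝ (Fin 3) → ℝ),
      IsMaximalSmoothSolution ν 0 u p T → IsLerayHopfOn T ν 0 (u 0) u →
      HasRapidSpatialDecay (u 0) → ∀ T' < T, HasBoundedSobolevNormsOn (Icc 0 T') u := by
  intro ν T hν hT u p hmax hLH hdec T' hT'
  set S : ℝ := max T' (T / 2) with hS
  have hS0 : 0 < S := lt_of_lt_of_le (by linarith) (le_max_right _ _)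
  have hST : S < T := max_lt hT' (by linarith)
  have hsol : IsClassicalNSSolutionOn (Icc 0 S) ν 0 u p :=
    hmax.1.mono (Icc_subset_Ico_right hST) (uniqueDiffOn_Icc hS0)
  have hE : ∃ C : ℝ≥0, ∀ t ∈ Icc 0 S, ∫⁻ x, ‖u t x‖ₑ ^ 2 ≤ C :=
    ⟨Real.toNNReal (2 * VectorCalculus.kineticEnergy (u 0)), fun t ht =>
      PlanarEnergyAPriori.lintegral_enorm_sq_le_of_isLerayHopfOn hLH hν.le ⟨ht.1, ht.2.trans hST.le⟩⟩
  exact (tao2011_hasBoundedSobolevNormsOn_holds hν hS0 hsol hE hdec).mono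
    (Icc_subset_Icc le_rfl (le_max_left _ _))

/-! ### `BudgetKillsHyperfast` -/

/-- A uniform `T'`-free majorant of the budget's bound shape on `[T/2, T]`: for `0 < T/2 ≤ T' ≤ T`,
`T'^e ≤ max (T^e) ((T/2)^e)` whatever the sign of `e`. [folklore] -/
theorem rpow_le_max_rpow {T T' e : ℝ} (hT : 0 < T) (h1 : T / 2 ≤ T') (h2 : T' ≤ T) :
    T' ^ e ≤ max (T ^ e) ((T / 2) ^ e) := by
  rcases le_or_gt 0 e with he | he
  · exact (Real.rpow_le_rpow (by linarith) h2 he).trans (le_max_left _ _)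
  · exact (Real.rpow_le_rpow_of_nonpos (by linarith) h1 he.le).trans (le_max_right _ _)

/-- **A sup-speed budget kills hyper-fast blow-up** (the package's `BudgetKillsHyperfast q β`,
unfolded, with `budgetBound` inlined).  Hypotheses: `1 ≤ q`, `1 ≤ β q`, and for some `K > 0` the
budget `∫₀ᵀ ‖u(t)‖_{L^∞}^q ≤ K (ν^{-3q/4} E^{q/2} T^{1-3q/4} + E^{2-q} ν^{3q-5})` for every classical
solution on a closed slab in the strong class with dissipation `≤ E`.  Conclusion: no maximal smooth
Leray–Hopf solution from a rapidly decaying datum, strong on closed sub-slabs, has a persistent sup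
rate `ofReal (c (T - t)^{-β}) ≤ ‖u(t)‖_{L^∞}` as `t ↑ T`, `c > 0`. [folklore] -/
theorem budgetKillsHyperfast {q β : ℝ} (hq : 1 ≤ q) (hβq : 1 ≤ β * q)
    (hB : ∃ K : ℝ, 0 < K ∧ ∀ ⦃ν : ℝ⦄, 0 < ν → ∀ ⦃T : ℝ⦄, 0 < T →
      ∀ (u : ℝ → EuclideanSpace ℝ (Fin 3) → EuclideanSpace ℝ (Fin 3))
        (p : ℝ → EuclideanSpace ℝ (Fin 3) → ℝ),
        IsClassicalNSSolutionOn (Icc 0 T) ν 0 u p → HasBoundedSobolevNormsOn (Icc 0 T) u →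
        ∀ ⦃E : ℝ⦄, 0 < E →
          ENNReal.ofReal ν *
              (∫⁻ t in Ioo 0 T, ∫⁻ x, ENNReal.ofReal (frobeniusNormSq (fderiv ℝ (u t) x))) ≤
            ENNReal.ofReal E →
          (∫⁻ t in Ioo 0 T, eLpNorm (u t) ∞ volume ^ q) ≤
            ENNReal.ofReal (K * (ν ^ (-(3 * q / 4)) * E ^ (q / 2) * T ^ (1 - 3 * q / 4) +
              E ^ (2 - q) * ν ^ (3 * q - 5)))) :
    ∀ (ν T : ℝ), 0 < ν → 0 < T →
      ∀ (u : ℝ → EuclideanSpace ℝ (Fin 3) → EuclideanSpace ℝ (Fin 3))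
        (p : ℝ → EuclideanSpace ℝ (Fin 3) → ℝ),
        IsMaximalSmoothSolution ν 0 u p T → IsLerayHopfOn T ν 0 (u 0) u →
        HasRapidSpatialDecay (u 0) → (∀ T' < T, HasBoundedSobolevNormsOn (Icc 0 T') u) →
        ∀ c : ℝ, 0 < c →
          ¬ ∀ᶠ t in 𝓝[<] T, ENNReal.ofReal (c * (T - t) ^ (-β)) ≤ eLpNorm (u t) ∞ volume := by
  intro ν T hν hT u p hmax hLH hdec hstrong c hc hrate
  obtain ⟨K, hK, hbudget⟩ := hB
  have hq0 : 0 ≤ q := zero_le_one.trans hq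
  -- ### Step 1: a dissipation bound uniform in the sub-slab (Tao 2013, Lemma 8.1)
  obtain ⟨C, hCtop, hC⟩ := tao_finite_energy_smooth_energy_bound_holds
  set A : ℝ≥0∞ := ∫⁻ x, ‖u 0 x‖ₑ ^ 2 with hA
  have hAle : A ≤ ENNReal.ofReal (2 * VectorCalculus.kineticEnergy (u 0)) :=
    PlanarEnergyAPriori.lintegral_enorm_sq_le_of_isLerayHopfOn hLH hν.le ⟨le_rfl, hT.le⟩
  have hAtop : A ≠ ⊤ := (hAle.trans_lt ENNReal.ofReal_lt_top).ne
  have hCAtop : C * A ≠ ⊤ := ENNReal.mul_ne_top hCtop.ne hAtop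
  set E : ℝ := (C * A).toReal + 1 with hE
  have hE0 : 0 < E := by have := ENNReal.toReal_nonneg (a := C * A); rw [hE]; linarith
  have hCAE : C * A ≤ ENNReal.ofReal E := by
    rw [hE, ← ENNReal.ofReal_toReal hCAtop]
    exact ENNReal.ofReal_le_ofReal (by rw [ENNReal.toReal_ofReal ENNReal.toReal_nonneg]; linarith)
  -- ### Step 2: the budget on every closed sub-slab `[0, T']`, `T/2 ≤ T' < T`, with a `T'`-free bound
  set e : ℝ := 1 - 3 * q / 4 with he
  set Mb : ℝ := K * (ν ^ (-(3 * q / 4)) * E ^ (q / 2) * max (T ^ e) ((T / 2) ^ e) +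
    E ^ (2 - q) * ν ^ (3 * q - 5)) with hMb
  have hsub : ∀ T' : ℝ, T / 2 ≤ T' → T' < T →
      (∫⁻ t in Ioo 0 T', eLpNorm (u t) ∞ volume ^ q) ≤ ENNReal.ofReal Mb := by
    intro T' h1 h2
    have hT'0 : 0 < T' := lt_of_lt_of_le (by linarith) h1
    have hsol : IsClassicalNSSolutionOn (Icc 0 T') ν 0 u p :=
      hmax.1.mono (Icc_subset_Ico_right h2) (uniqueDiffOn_Icc hT'0)
    have hfe : ∃ A' : ℝ≥0∞, A' < ⊤ ∧ ∀ t ∈ Icc 0 T', ∫⁻ x, ‖u t x‖ₑ ^ 2 ≤ A' :=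
      ⟨ENNReal.ofReal (2 * VectorCalculus.kineticEnergy (u 0)), ENNReal.ofReal_lt_top, fun t ht =>
        PlanarEnergyAPriori.lintegral_enorm_sq_le_of_isLerayHopfOn hLH hν.le ⟨ht.1, ht.2.trans h2.le⟩⟩
    have hdiss : ENNReal.ofReal ν *
        (∫⁻ t in Ioo 0 T', ∫⁻ x, ENNReal.ofReal (frobeniusNormSq (fderiv ℝ (u t) x))) ≤
        ENNReal.ofReal E :=
      ((hC ν T' hν hT'0 u p hsol hfe).2).trans hCAE
    refine (hbudget hν hT'0 u p hsol (hstrong T' h2) hE0 hdiss).trans (ENNReal.ofReal_le_ofReal ?_)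
    rw [hMb]
    have hpow : T' ^ e ≤ max (T ^ e) ((T / 2) ^ e) := rpow_le_max_rpow hT h1 h2.le
    have hc1 : 0 ≤ ν ^ (-(3 * q / 4)) * E ^ (q / 2) :=
      mul_nonneg (Real.rpow_nonneg hν.le _) (Real.rpow_nonneg hE0.le _)
    have := mul_le_mul_of_nonneg_left hpow hc1
    nlinarith [hK.le]
  -- ### Step 3: exhaustion — the budget on the whole of `(0, T)`
  have htot : (∫⁻ t in Ioo 0 T, eLpNorm (u t) ∞ volume ^ q) ≤ ENNReal.ofReal Mb := by
    set Tn : ℕ → ℝ := fun n => T - T / ((n : ℝ) + 2) with hTn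
    have hTn_ge : ∀ n, T / 2 ≤ Tn n := fun n => by
      have : T / ((n : ℝ) + 2) ≤ T / 2 :=
        div_le_div_of_nonneg_left hT.le (by norm_num) (by linarith [Nat.cast_nonneg (α := ℝ) n])
      simp only [hTn]; linarith
    have hTn_lt : ∀ n, Tn n < T := fun n => by
      have : 0 < T / ((n : ℝ) + 2) := by positivity
      simp only [hTn]; linarith
    have hTn_mono : Monotone Tn := by
      intro m n hmn
      simp only [hTn]
      have hm2 : (0 : ℝ) < (m : ℝ) + 2 := by positivity
      have hmn' : (m : ℝ) + 2 ≤ (n : ℝ) + 2 := by exact_mod_cast Nat.add_le_add_right hmn 2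
      have := div_le_div_of_nonneg_left hT.le hm2 hmn'
      linarith
    have hU : (⋃ n, Ioo 0 (Tn n)) = Ioo 0 T := by
      ext t
      simp only [mem_iUnion, mem_Ioo]
      constructor
      · rintro ⟨n, h0, h1⟩
        exact ⟨h0, h1.trans (hTn_lt n)⟩
      · rintro ⟨h0, h1⟩
        obtain ⟨n, hn⟩ := exists_nat_gt (T / (T - t))
        refine ⟨n, h0, ?_⟩
        simp only [hTn]
        have hTt : 0 < T - t := sub_pos.2 h1
        have hn2 : T / (T - t) < (n : ℝ) + 2 := by linarith
        have : T / ((n : ℝ) + 2) < T - t := by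
          rw [div_lt_iff₀ (by positivity)]
          rw [div_lt_iff₀ hTt] at hn2
          nlinarith
        linarith
    have hdir : Directed (· ⊆ ·) fun n => Ioo 0 (Tn n) :=
      Monotone.directed_le fun m n hmn => Ioo_subset_Ioo le_rfl (hTn_mono hmn)
    rw [← hU, setLIntegral_iUnion_of_directed _ hdir]
    exact iSup_le fun n => hsub (Tn n) (hTn_ge n) (hTn_lt n)
  -- ### Step 4: the persistent rate makes the budget diverge
  obtain ⟨l, hlT, hl⟩ := mem_nhdsLT_iff_exists_Ioo_subset.1 hrate
  set δ : ℝ := min (T - max l 0) 1 with hδ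
  have hδ0 : 0 < δ := lt_min (by have := max_lt hlT hT; linarith) one_pos
  have hδ1 : δ ≤ 1 := min_le_right _ _
  have hIoo : Ioo (T - δ) T ⊆ Ioo l T ∩ Ioo 0 T := fun t ht => by
    have hd : δ ≤ T - max l 0 := min_le_left _ _
    exact ⟨⟨by linarith [le_max_left l 0, ht.1], ht.2⟩, ⟨by linarith [le_max_right l 0, ht.1], ht.2⟩⟩
  have hlow : ∀ t ∈ Ioo (T - δ) T,
      ENNReal.ofReal (c ^ q * (T - t)⁻¹) ≤ eLpNorm (u t) ∞ volume ^ q := by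
    intro t ht
    have hTt : 0 < T - t := sub_pos.2 ht.2
    have hTt1 : T - t ≤ 1 := by linarith [ht.1]
    have hr : ENNReal.ofReal (c * (T - t) ^ (-β)) ≤ eLpNorm (u t) ∞ volume := hl (hIoo ht).1
    have hcq : 0 ≤ c * (T - t) ^ (-β) := mul_nonneg hc.le (Real.rpow_nonneg hTt.le _)
    calc ENNReal.ofReal (c ^ q * (T - t)⁻¹)
        ≤ ENNReal.ofReal ((c * (T - t) ^ (-β)) ^ q) := by
          refine ENNReal.ofReal_le_ofReal ?_
          rw [Real.mul_rpow hc.le (Real.rpow_nonneg hTt.le _), ← Real.rpow_mul hTt.le,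
            ← Real.rpow_neg_one]
          refine mul_le_mul_of_nonneg_left ?_ (Real.rpow_nonneg hc.le _)
          exact Real.rpow_le_rpow_of_exponent_ge hTt hTt1 (by nlinarith)
      _ = ENNReal.ofReal (c * (T - t) ^ (-β)) ^ q := (ENNReal.ofReal_rpow_of_nonneg hcq hq0).symm
      _ ≤ eLpNorm (u t) ∞ volume ^ q := ENNReal.rpow_le_rpow hr hq0
  have hdiv : ∫⁻ t in Ioo (T - δ) T, ENNReal.ofReal (c ^ q * (T - t)⁻¹) = ⊤ := by
    have hcq0 : 0 < c ^ q := Real.rpow_pos_of_pos hc q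
    have h1 : ∫⁻ t in Ioo (T - δ) T, ENNReal.ofReal (c ^ q * (T - t)⁻¹) =
        ENNReal.ofReal (c ^ q) * ∫⁻ t in Ioo (T - δ) T, ENNReal.ofReal ((T - t)⁻¹) := by
      rw [← lintegral_const_mul' _ _ ENNReal.ofReal_ne_top]
      refine setLIntegral_congr_fun measurableSet_Ioo fun t ht => ?_
      rw [ENNReal.ofReal_mul hcq0.le]
    rw [h1, lintegral_inv_sub_Ioo_eq_top T hδ0, ENNReal.mul_top (ENNReal.ofReal_pos.2 hcq0).ne']
  have hle : ∫⁻ t in Ioo (T - δ) T, ENNReal.ofReal (c ^ q * (T - t)⁻¹) ≤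
      ∫⁻ t in Ioo 0 T, eLpNorm (u t) ∞ volume ^ q :=
    (setLIntegral_mono_ae' measurableSet_Ioo (ae_of_all _ hlow)).trans
      (lintegral_mono_set fun t ht => (hIoo ht).2)
  rw [hdiv] at hle
  exact absurd (htot.trans_lt ENNReal.ofReal_lt_top) (not_lt.2 hle)

end Summit.NavierStokesRegularity.NavierStokesRegularity.Theorems.TypeIliouvilleNoTypeII.RateChain

end
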